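import Mathlib

/-!
# `Balaban1983to89.B14Interpolation` — [Balaban1988Convergent] §3, (3.26)–(3.27) p. 271, (3.30) p. 272,
(3.32) p. 273: the parameter-interpolation identities decomposing the logarithm of the fluctuation-field integral

statement-level skeleton of published theorems with citation tags; proofs where landed; nothing here is a
claim about the Yang–Mills mass gap

CITATION HEADER (lean-in-tree rule).  Source: T. Bałaban, *Convergent renormalization expansions for lattice gauge
theories*, Commun. Math. Phys. **119**, 243–285 (1988), doi:10.1007/bf01217741 [Balaban1988Convergent] (cell paper
B14; held `paper:balaban1988-cmp119-convergent-renormalization`, journal page = PDF page + 242; displays read on the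
x2 renders p029, p030, p031 of `run/shared/lean/pub/pub-balaban/b2b-balaban-ref1/pages/1988-cmp119-…/`).
Mega-formalization `lit-balaban`, unit `lit-balaban-r11` (CMP 119), SKELETON rows B14-3.26, B14-3.27, B14-3.30, B14-3.32.

THE PRINTED TEXT (verbatim, pp. 271–273 [PDF 29–31]).
* *"Introduce now auxiliary parameters s, t, the parameter t multiplying the expressions 𝐁_k, A((1/g_k²(·)) −
  (1/g_k²), …), V^{(k)}, s multiplying 𝐑″_k. We have
  log[z^{(k)} ∫ dA χ^{(k)} exp[−½⟨A, C*Δ^{(k)}CA⟩ − ….]]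
   = ∫₀¹ dt ⟨{𝐁_k(U_k(….)) − 𝐁_k(U_{k+1}) + A(1/g_k²(·) − 1/g_k², U_k(….)) − A(1/g_k²(·) − 1/g_k², U_{k+1})}
       + V^{(k)}(S_{k+1})⟩_{s=1,t}
   + ∫₀¹ ds ⟨{𝐑″_k(U_k(….)) − 𝐑″_k(U_{k+1})}⟩_{s,t=0}
   + log[z^{(k)} ∫ dA χ^{(k)} exp[−½⟨A, C*Δ^{(k)}CA⟩ − ….(s = 0, t = 0)….]].   (3.26)
  Here ⟨·⟩_{s,t} denotes the expectation value with respect to the probabilistic measure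
  Z_{s,t}^{−1} dμ_{C^{(k)}(Λ_{k+1})}(A) χ_k exp[−⟨A, C*Δ^{(k)}CA_k⟩ + 𝐏^{(k)} + {….}_{s,t} + tV^{(k)}(S_k)],   (3.27)
  where the introduction of the parameters s, t was described above, and Z_{s,t} is the normalization factor."*
* p. 272: *"Multiplying g_k by the parameter t we have  [the logarithm on the right-hand side of (3.28)]
  = log[z^{(k)} ∫ dA exp[−½⟨A, C*Δ^{(k)}CA⟩]] + log[…] + ∫₀¹ dt ⟨(d/dt)(−𝐏^{(k)}(tg_k, A) + … E_k(U_k(…tg_kCA…)))⟩_t, (3.30)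
  where the expectation value is with respect to the probabilistic measure defined by the function χ^{(k)} exp[…tg_k…]
  in the logarithm, but with the constant g_k replaced by tg_k."*
* p. 273: *"Denote the characteristic function with the parameter t multiplying the variables A by χ_t^{(k)}. Thus
  there is the function χ_1^{(k)} in this expression, and χ_0^{(k)} = 1. We have
  log ∫ dμ_{C^{(k)}(Λ_{k+1})} χ_1^{(k)} = ∫₀¹ dt ∫ dμ_{C^{(k)}(Λ_{k+1})} ((d/dt)χ_t^{(k)}) (∫ dμ χ_t^{(k)})^{−1}, (3.32)"*.

WHAT IS TYPED, AND WHAT IS PROVED.  The three displays share one elementary mechanism: a (one- or two-) parameter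
family `Z(s,t) > 0` of integrals, `log Z` differentiated in a parameter, the derivative identified with an
expectation in the tilted probability measure (3.27), and the fundamental theorem of calculus along the path
`(0,0) → (1,0) → (1,1)` ((3.26)) or `0 → 1` ((3.30), (3.32)).  Typed here over ABSTRACT data — `logZ : ℝ → ℝ → ℝ`
and the two expectation functions `expT`, `expS` of (3.27) — are the printed identity `Eq326` and its one-parameter
form `Eq330`; PROVED are (i) `eq326_of_hasDerivAt` / `eq330_of_hasDerivAt`: the identities follow from
"∂_t log Z(1,t) = ⟨·⟩_{1,t}, ∂_s log Z(s,0) = ⟨·⟩_{s,0}" (resp. "∂_t log Z(t) = ⟨·⟩_t") by the fundamental theorem of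
calculus; (ii) `hasDerivAt_log_tiltedSum`: in the finite model `Z(t) = Σ_i w_i e^{tY_i}`, `w_i > 0`, the derivative of
`log Z` IS the tilted expectation `Σ_i Y_i w_i e^{tY_i} / Z(t)` — the content of the sentence defining `⟨·⟩_{s,t}` in
(3.27), at the level where no interchange of limit and integral is needed.  The measure-theoretic interchange for
the actual fluctuation integrals (compact domain cut out by `χ^{(k)}`, analytic integrand) is NOT typed here.
Nothing printed is asserted; no `sorry`, no axiom.
-/

namespace Literature.MathematicalPhysics.QuantumFieldTheory.Balaban1983to89.B14.Interpolation

open scoped BigOperators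
open MeasureTheory intervalIntegral

/-- **(3.26) p. 271**, typed over abstract data: `logZ s t` = the logarithm of the fluctuation-field integral with
the interpolation parameters `(s,t)` (`s` multiplying `𝐑″_k`, `t` multiplying the boundary expressions), `expT s t`
= the expectation `⟨{𝐁_k(U_k(…)) − 𝐁_k(U_{k+1}) + A(…) − A(…)} + V^{(k)}(S_{k+1})⟩_{s,t}` and `expS s t` =
`⟨{𝐑″_k(U_k(…)) − 𝐑″_k(U_{k+1})}⟩_{s,t}` of (3.27).  The display:
`log Z(1,1) = ∫₀¹ dt expT(1,t) + ∫₀¹ ds expS(s,0) + log Z(0,0)`. [cite: Balaban1988Convergent, (3.26) p.271] -/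
def Eq326 (logZ expT expS : ℝ → ℝ → ℝ) : Prop :=
  logZ 1 1 = (∫ t in (0:ℝ)..1, expT 1 t) + (∫ s in (0:ℝ)..1, expS s 0) + logZ 0 0

/-- **(3.30) p. 272 / (3.32) p. 273**, the one-parameter form: `log Z(1) = log Z(0) + ∫₀¹ dt ⟨∂_t(action)⟩_t`
(in (3.30) the parameter multiplies `g_k` and `log Z(0)` is the Gaussian logarithm; in (3.32) it multiplies the
variables of the characteristic function and `log Z(0) = log ∫dμ χ₀^{(k)} = log ∫ dμ = 0` for the normalized
Gaussian measure). [cite: Balaban1988Convergent, (3.30) p.272, (3.32) p.273] -/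
def Eq330 (logZ expT : ℝ → ℝ) : Prop :=
  logZ 1 = logZ 0 + ∫ t in (0:ℝ)..1, expT t

/-- **(3.26) from (3.27) by the fundamental theorem of calculus** along `(0,0) → (1,0) → (1,1)`: if
`∂_s log Z(s,0) = expS(s,0)` and `∂_t log Z(1,t) = expT(1,t)` on `[0,1]` (the derivative of the logarithm of the
tilted integral is the tilted expectation — the meaning of `⟨·⟩_{s,t}` in (3.27)), and the two expectations are
interval-integrable, then (3.26) holds. [cite: Balaban1988Convergent, (3.26)-(3.27) p.271] -/
theorem eq326_of_hasDerivAt (logZ expT expS : ℝ → ℝ → ℝ)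
    (hT : ∀ t ∈ Set.uIcc (0:ℝ) 1, HasDerivAt (fun t => logZ 1 t) (expT 1 t) t)
    (hS : ∀ s ∈ Set.uIcc (0:ℝ) 1, HasDerivAt (fun s => logZ s 0) (expS s 0) s)
    (hTi : IntervalIntegrable (fun t => expT 1 t) volume 0 1)
    (hSi : IntervalIntegrable (fun s => expS s 0) volume 0 1) :
    Eq326 logZ expT expS := by
  unfold Eq326
  have h1 : ∫ t in (0:ℝ)..1, expT 1 t = logZ 1 1 - logZ 1 0 :=
    integral_eq_sub_of_hasDerivAt hT hTi
  have h2 : ∫ s in (0:ℝ)..1, expS s 0 = logZ 1 0 - logZ 0 0 :=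
    integral_eq_sub_of_hasDerivAt hS hSi
  rw [h1, h2]; ring

/-- **(3.30)/(3.32) by the fundamental theorem of calculus**: `∂_t log Z(t) = ⟨·⟩_t` on `[0,1]`, integrable, gives
`log Z(1) = log Z(0) + ∫₀¹ ⟨·⟩_t dt`. [cite: Balaban1988Convergent, (3.30) p.272, (3.32) p.273] -/
theorem eq330_of_hasDerivAt (logZ expT : ℝ → ℝ)
    (hT : ∀ t ∈ Set.uIcc (0:ℝ) 1, HasDerivAt logZ (expT t) t)
    (hTi : IntervalIntegrable expT volume 0 1) : Eq330 logZ expT := by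
  unfold Eq330
  have h1 : ∫ t in (0:ℝ)..1, expT t = logZ 1 - logZ 0 := integral_eq_sub_of_hasDerivAt hT hTi
  rw [h1]; ring

/-! ## The finite model of (3.27): the derivative of `log Z` is the tilted expectation -/

/-- The tilted partition function of a finite family: `Z(t) = Σ_i w_i e^{tY_i}` (weights `w_i` = the unperturbed
measure, `Y_i` = the expression multiplied by the parameter). [cite: Balaban1988Convergent, (3.27) p.271] -/
noncomputable def tiltedSum {ι : Type*} (u : Finset ι) (w Y : ι → ℝ) (t : ℝ) : ℝ :=
  ∑ i ∈ u, w i * Real.exp (t * Y i)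

/-- The tilted expectation `⟨Y⟩_t = Σ_i Y_i w_i e^{tY_i} / Z(t)` — the finite model of `⟨·⟩_{s,t}` in (3.27)
(*"the expectation value with respect to the probabilistic measure Z_{s,t}^{−1} dμ … exp[… + t V …]"*).
[cite: Balaban1988Convergent, (3.27) p.271] -/
noncomputable def tiltedExp {ι : Type*} (u : Finset ι) (w Y : ι → ℝ) (t : ℝ) : ℝ :=
  (∑ i ∈ u, Y i * (w i * Real.exp (t * Y i))) / tiltedSum u w Y t

/-- Positivity of the tilted partition function (positive weights, nonempty family) — what makes `log Z(t)` and
the normalization `Z_{s,t}^{−1}` of (3.27) meaningful. [cite: Balaban1988Convergent, (3.27) p.271] -/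
theorem tiltedSum_pos {ι : Type*} (u : Finset ι) (hu : u.Nonempty) (w Y : ι → ℝ) (hw : ∀ i ∈ u, 0 < w i)
    (t : ℝ) : 0 < tiltedSum u w Y t := by
  unfold tiltedSum
  apply Finset.sum_pos
  · intro i hi; exact mul_pos (hw i hi) (Real.exp_pos _)
  · exact hu

/-- `d/dt Σ_i w_i e^{tY_i} = Σ_i Y_i w_i e^{tY_i}` — the numerator of the tilted expectation (3.27).
[cite: Balaban1988Convergent, (3.27) p.271] -/
theorem hasDerivAt_tiltedSum {ι : Type*} (u : Finset ι) (w Y : ι → ℝ) (t : ℝ) :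
    HasDerivAt (tiltedSum u w Y) (∑ i ∈ u, Y i * (w i * Real.exp (t * Y i))) t := by
  unfold tiltedSum
  have h : ∀ i ∈ u, HasDerivAt (fun t => w i * Real.exp (t * Y i)) (Y i * (w i * Real.exp (t * Y i))) t := by
    intro i _
    have h1 : HasDerivAt (fun t => t * Y i) (1 * Y i) t := (hasDerivAt_id' t).mul_const (Y i)
    exact ((h1.exp).const_mul (w i)).congr_deriv (by ring)
  exact HasDerivAt.fun_sum h

/-- **The meaning of `⟨·⟩_{s,t}` in (3.27), finite model**: for positive weights on a nonempty finite family,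
`d/dt log Σ_i w_i e^{tY_i} = Σ_i Y_i w_i e^{tY_i} / Σ_i w_i e^{tY_i} = ⟨Y⟩_t`.  With `eq330_of_hasDerivAt` this gives
(3.30)/(3.32) in the finite model, and, applied in each parameter separately, (3.26). [cite: Balaban1988Convergent, (3.26)-(3.27) p.271] -/
theorem hasDerivAt_log_tiltedSum {ι : Type*} (u : Finset ι) (hu : u.Nonempty) (w Y : ι → ℝ)
    (hw : ∀ i ∈ u, 0 < w i) (t : ℝ) :
    HasDerivAt (fun t => Real.log (tiltedSum u w Y t)) (tiltedExp u w Y t) t := by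
  unfold tiltedExp
  exact (hasDerivAt_tiltedSum u w Y t).log (ne_of_gt (tiltedSum_pos u hu w Y hw t))

/-- (3.30)/(3.32) in the finite model, end to end: `log Z(1) = log Z(0) + ∫₀¹ ⟨Y⟩_t dt` for
`Z(t) = Σ_i w_i e^{tY_i}`, `w_i > 0`. [cite: Balaban1988Convergent, (3.30) p.272, (3.32) p.273] -/
theorem eq330_tiltedSum {ι : Type*} (u : Finset ι) (hu : u.Nonempty) (w Y : ι → ℝ) (hw : ∀ i ∈ u, 0 < w i) :
    Eq330 (fun t => Real.log (tiltedSum u w Y t)) (tiltedExp u w Y) := by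
  apply eq330_of_hasDerivAt
  · intro t _; exact hasDerivAt_log_tiltedSum u hu w Y hw t
  · apply Continuous.intervalIntegrable
    have hc : Continuous (tiltedSum u w Y) := by
      unfold tiltedSum
      exact continuous_finsetSum _ (fun i _ => continuous_const.mul ((continuous_id.mul continuous_const).rexp))
    unfold tiltedExp
    apply Continuous.div
    · exact continuous_finsetSum _
        (fun i _ => continuous_const.mul (continuous_const.mul ((continuous_id.mul continuous_const).rexp)))
    · exact hc
    · intro t; exact ne_of_gt (tiltedSum_pos u hu w Y hw t)

end Literature.MathematicalPhysics.QuantumFieldTheory.Balaban1983to89.B14.Interpolation
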